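import Summits.NavierStokesRegularity.NavierStokesRegularity.Theorems.ExtremiserTransienceHomogeneousSharpConstant
import Summits.NavierStokesRegularity.NavierStokesRegularity.Theorems.ExtremiserTransienceGalileanGainOfDecaying
import HarnessLib

/-!
# Route `ExtremiserTransience`, item `DecayingSharpConstant` (stmt-NavierStokesRegularity-26687) — PROVED

`--workitem stmt-NavierStokesRegularity-26687`.  Author: prover seat `ns-el-k1b` (g2).

`κ⋆` is universal on homogeneous-class fields tending to `0` at infinity: the decaying class is a subclass of the
homogeneous class, on which `HomogeneousSharpConstant` (stmt-26686, `homogeneousSharpConstant_proof`) holds; the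
implication is the landed `DepletionLadder.GalileanGauge.decayingSharpConstant_of_homogeneous`.

WHAT THIS IS NOT: a static inequality on admissible fields; rung N0 and NS regularity stay OPEN — nothing here proves
NS regularity. [folklore]
-/

noncomputable section

namespace Summit.NavierStokesRegularity.NavierStokesRegularity.Theorems

-- the problem directory repeats the summit name (`NavierStokesRegularity/NavierStokesRegularity`)
set_option linter.dupNamespace false

/-- **`DecayingSharpConstant` (stmt-NavierStokesRegularity-26687) holds.** [folklore] -/
theorem decayingSharpConstant_proof :
    Summit.NavierStokesRegularity.NavierStokesRegularity.Theses.ExtremiserTransience.DecayingSharpConstant :=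
  DepletionLadder.GalileanGauge.decayingSharpConstant_of_homogeneous homogeneousSharpConstant_proof

end Summit.NavierStokesRegularity.NavierStokesRegularity.Theorems

end
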